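import Summits.KontsevichZagierPeriods.KontsevichZagierPeriods.Theorems.SoloBlindLineMoves
import Summits.KontsevichZagierPeriods.KontsevichZagierPeriods.Theorems.SoloBlindMoebius
import Mathlib.Analysis.SpecialFunctions.Integrals.Basic
import Mathlib.Algebra.Order.Group.Pointwise.Interval
import HarnessLib

/-!
# The Kontsevich–Zagier conjecture in dimension `≤ 1`, Ic: logarithmic and arctangent cells

The standard cells of the one-variable normal form and their move algebra inside
`KZ.relations`:
* `L(c; a, b) = [[a, b], c/x]` (`0 < a`), value `c log (b/a)`; `L(c; λ) = L(c; 1, λ)`;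
* `A(d; a, b) = [[a, b], d/(1+x²)]`, value `d (arctan b − arctan a)`; `A(d; τ) = A(d; 0, τ)`.
Coefficient additivity and integer scaling, splitting, dilation `L(c; a, b) ≡ L(c; sa, sb)`,
reflection `A(d; a, b) ≡ A(d; −b, −a)`, the MÖBIUS MOVE `A(d; 0, (ρ−σ)/(1+σρ)) ≡ A(d; σ, ρ)`
(the substitution `v = (u+σ)/(1−σu)` preserves `du/(1+u²)` because
`(1−σu)² + (u+σ)² = (1+σ²)(1+u²)`), and the two PEELING MOVES
`L(c; μ) ≡ L(c; λ) + L(c; μ/λ)` (`1 ≤ λ ≤ μ`) and `A(d; ρ) ≡ A(d; τ) + A(d; (ρ−τ)/(1+τρ))`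
(`0 ≤ τ ≤ ρ`), which realise inside the move group the functional equations of `log` and
`arctan` on which the injectivity half of the dimension-`≤ 1` theorem rests.

Reference: M. Kontsevich, D. Zagier, *Periods* (2001), §1.2.
-/

noncomputable section

open MeasureTheory Set Filter
open scoped BigOperators Topology

namespace Summit.KontsevichZagierPeriods.KontsevichZagierPeriods.Theorems

open Literature.NumberTheory.Transcendental
open Literature.NumberTheory.Transcendental.KZ
open Literature.ModelTheory.ExponentialFields (IsSemialgebraic isSemialgebraic_univ)

namespace SoloBlind

/-! ## The logarithmic cell `L(c; a, b) = [[a, b], c/x]` -/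

/-- `x ↦ c/x` is `ℚ`-semialgebraic on `line [a, b]`, `0 < a`, `c` real algebraic. -/
theorem isSemialgebraicFunOn_log_integrand {c a b : ℝ} (hc : IsAlgebraic ℚ c)
    (hS : IsSemialgebraic ℚ (line (Icc a b))) (h0 : 0 < a) :
    IsSemialgebraicFunOn ℚ (line (Icc a b)) (fun x => c / x 0) :=
  (isSemialgebraicFunOn_const_of_isAlgebraic hS hc).div (isSemialgebraicFunOn_apply hS 0)
    fun _ hx => (h0.trans_le hx.1).ne'

/-- `t ↦ c/t` is integrable on `[a, b]` for `0 < a`. -/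
theorem integrableOn_log_integrand (c : ℝ) {a b : ℝ} (h0 : 0 < a) :
    IntegrableOn (fun t : ℝ => c / t) (Icc a b) :=
  (continuousOn_const.div continuousOn_id fun _ ht => (h0.trans_le ht.1).ne').integrableOn_compact
    isCompact_Icc

/-- The logarithmic cell `L(c; a, b) = [[a, b], c/x]`, `0 < a`, `a, b, c` real algebraic. -/
def logSeg (c a b : ℝ) (hc : IsAlgebraic ℚ c) (ha : IsAlgebraic ℚ a) (hb : IsAlgebraic ℚ b)
    (h0 : 0 < a) : IntegralRep 1 :=
  lineRep (Icc a b) (fun t => c / t) (isSemialgebraic_line_Icc ha hb)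
    (isSemialgebraicFunOn_log_integrand hc (isSemialgebraic_line_Icc ha hb) h0)
    (integrableOn_log_integrand c h0)

section logSeg

variable {c a b : ℝ} {hc : IsAlgebraic ℚ c} {ha : IsAlgebraic ℚ a} {hb : IsAlgebraic ℚ b}
  {h0 : 0 < a}

/-- The domain of `L(c; a, b)`. -/
@[simp] theorem logSeg_domain : (logSeg c a b hc ha hb h0).domain = line (Icc a b) := rfl

/-- The integrand of `L(c; a, b)`. -/
@[simp] theorem logSeg_integrand : (logSeg c a b hc ha hb h0).integrand = fun x => c / x 0 := rfl

/-- `value L(c; a, b) = c log (b/a)` (`a ≤ b`). -/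
theorem value_logSeg (hab : a ≤ b) : (logSeg c a b hc ha hb h0).value = c * Real.log (b / a) := by
  rw [logSeg, value_lineRep, integral_Icc_eq_integral_Ioc, ← intervalIntegral.integral_of_le hab]
  simp_rw [div_eq_mul_inv]
  rw [intervalIntegral.integral_const_mul, integral_inv_of_pos h0 (h0.trans_le hab)]
  rw [div_eq_mul_inv]

/-- A degenerate or empty logarithmic cell is a relation. -/
theorem logSeg_null (hba : b ≤ a) : of (logSeg c a b hc ha hb h0) ∈ relations :=
  of_mem_relations_of_volume_eq_zero _ (by
    rw [logSeg_domain, volume_line]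
    exact measure_mono_null (fun x hx => le_antisymm (hx.2.trans hba) hx.1) Real.volume_singleton)

/-- `L(0; a, b) ≡ 0`. -/
theorem logSeg_coeff_zero {h : IsAlgebraic ℚ (0:ℝ)} : of (logSeg 0 a b h ha hb h0) ∈ relations :=
  of_mem_relations_of_eqOn_zero _ fun x _ => by simp

/-- `L(c₁ + c₂; a, b) ≡ L(c₁; a, b) + L(c₂; a, b)`. -/
theorem logSeg_coeff_add {c₁ c₂ : ℝ} {h₁ : IsAlgebraic ℚ c₁} {h₂ : IsAlgebraic ℚ c₂}
    {h₁₂ : IsAlgebraic ℚ (c₁ + c₂)} :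
    of (logSeg (c₁ + c₂) a b h₁₂ ha hb h0) - of (logSeg c₁ a b h₁ ha hb h0) -
      of (logSeg c₂ a b h₂ ha hb h0) ∈ relations :=
  of_sub_sub_mem_relations_of_add rfl rfl fun x _ => by simp [add_div]

/-- `L(c; a, b) + L(−c; a, b) ≡ 0`. -/
theorem logSeg_coeff_neg {hc' : IsAlgebraic ℚ (-c)} :
    of (logSeg c a b hc ha hb h0) + of (logSeg (-c) a b hc' ha hb h0) ∈ relations :=
  of_add_of_mem_relations_of_neg rfl fun x _ => by simp [neg_div]

/-- `L(k c; a, b) ≡ k • L(c; a, b)` for `k ∈ ℤ`. -/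
theorem logSeg_coeff_zsmul (k : ℤ) {hkc : IsAlgebraic ℚ (k * c)} :
    of (logSeg (k * c) a b hkc ha hb h0) - k • of (logSeg c a b hc ha hb h0) ∈ relations :=
  of_sub_zsmul_mem_relations k rfl fun x _ => by simp [mul_div_assoc]

/-- Cells with equal parameters are equal representations. -/
theorem logSeg_congr {c' a' b' : ℝ} (h₁ : c = c') (h₂ : a = a') (h₃ : b = b')
    {hc' : IsAlgebraic ℚ c'} {ha' : IsAlgebraic ℚ a'} {hb' : IsAlgebraic ℚ b'} {h0' : 0 < a'} :
    logSeg c a b hc ha hb h0 = logSeg c' a' b' hc' ha' hb' h0' := by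
  subst h₁ h₂ h₃; rfl

/-- Splitting a logarithmic cell: `L(c; a, b) ≡ L(c; a, l) + L(c; l, b)` for `a ≤ l ≤ b`. -/
theorem logSeg_split {l : ℝ} (hal : a ≤ l) (hlb : l ≤ b) {hl : IsAlgebraic ℚ l} {hl0 : 0 < l} :
    of (logSeg c a b hc ha hb h0) - of (logSeg c a l hc ha hl h0) -
      of (logSeg c l b hc hl hb hl0) ∈ relations :=
  lineRep_split hal hlb _

/-- Dilating a logarithmic cell: `L(c; a, b) ≡ L(c; s a, s b)` for `s > 0` real algebraic. -/
theorem logSeg_dilate {s : ℝ} (hs : IsAlgebraic ℚ s) (hs0 : 0 < s) {a' b' : ℝ} (ha' : a' = s * a)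
    (hb' : b' = s * b) {hA : IsAlgebraic ℚ a'} {hB : IsAlgebraic ℚ b'} {h0' : 0 < a'} :
    of (logSeg c a b hc ha hb h0) - of (logSeg c a' b' hc hA hB h0') ∈ relations := by
  refine lineRep_dilate hs hs0.ne' ?_ ?_
  · rw [ha', hb']
    exact (image_mul_left_Icc' hs0 a b).symm
  · intro t ht
    have ht0 : t ≠ 0 := (h0.trans_le ht.1).ne'
    rw [abs_of_pos hs0]
    field_simp

end logSeg

/-- The standard logarithmic cell `L(c; λ) = [[1, λ], c/x]`, value `c log λ`. -/
def logCell (c l : ℝ) (hc : IsAlgebraic ℚ c) (hl : IsAlgebraic ℚ l) : IntegralRep 1 :=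
  logSeg c 1 l hc isAlgebraic_one hl one_pos

section logCell

variable {c l : ℝ} {hc : IsAlgebraic ℚ c} {hl : IsAlgebraic ℚ l}

/-- Unfolding `L(c; λ) = L(c; 1, λ)`. -/
theorem logCell_eq : logCell c l hc hl = logSeg c 1 l hc isAlgebraic_one hl one_pos := rfl

/-- Standard logarithmic cells with equal parameters are equal. -/
theorem logCell_congr {c' l' : ℝ} (h₁ : c = c') (h₂ : l = l') {hc' : IsAlgebraic ℚ c'}
    {hl' : IsAlgebraic ℚ l'} : logCell c l hc hl = logCell c' l' hc' hl' := by
  subst h₁ h₂; rfl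

/-- `value L(c; λ) = c log λ` (`1 ≤ λ`). -/
theorem value_logCell (h1 : 1 ≤ l) : (logCell c l hc hl).value = c * Real.log l := by
  rw [logCell_eq, value_logSeg h1, div_one]

/-- **Peeling move for logarithms**: `L(c; μ) ≡ L(c; λ) + L(c; μ/λ)` for `1 ≤ λ ≤ μ`
(split at `λ`, then dilate `[λ, μ]` by `λ⁻¹`). -/
theorem logCell_peel {m : ℝ} {hm : IsAlgebraic ℚ m} (h1 : 1 ≤ l) (hlm : l ≤ m)
    {hml : IsAlgebraic ℚ (m / l)} :
    of (logCell c m hc hm) - of (logCell c l hc hl) - of (logCell c (m / l) hc hml) ∈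
      relations := by
  have hl0 : 0 < l := one_pos.trans_le h1
  have hsplit := logSeg_split (c := c) (a := 1) (b := m) (hc := hc) (ha := isAlgebraic_one)
    (hb := hm) (h0 := one_pos) h1 hlm (hl := hl) (hl0 := hl0)
  have hdil := logSeg_dilate (c := c) (a := 1) (b := m / l) (hc := hc) (ha := isAlgebraic_one)
    (hb := hml) (h0 := one_pos) hl hl0 (a' := l) (b' := m) (by ring)
    (by field_simp) (hA := hl) (hB := hm) (h0' := hl0)
  have := relations.sub_mem hsplit hdil
  convert this using 1
  simp only [logCell_eq]
  abel

end logCell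

/-! ## The arctangent cell `A(d; a, b) = [[a, b], d/(1+x²)]` -/

/-- `x ↦ d/(1+x²)` is `ℚ`-semialgebraic on any `ℚ`-semialgebraic line set, `d` real algebraic. -/
theorem isSemialgebraicFunOn_atan_integrand {d : ℝ} (hd : IsAlgebraic ℚ d) {S : Set ℝ}
    (hS : IsSemialgebraic ℚ (line S)) :
    IsSemialgebraicFunOn ℚ (line S) (fun x => d / (1 + x 0 ^ 2)) := by
  refine (isSemialgebraicFunOn_const_of_isAlgebraic hS hd).div ?_ fun x _ => by positivity
  exact (isSemialgebraicFunOn_aeval hS (1 + MvPolynomial.X 0 ^ 2 : MvPolynomial (Fin 1) ℚ)).congr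
    fun x _ => by simp

/-- `t ↦ d/(1+t²)` is continuous. -/
theorem continuous_atan_integrand (d : ℝ) : Continuous fun t : ℝ => d / (1 + t ^ 2) :=
  continuous_const.div (continuous_const.add (continuous_id.pow 2)) fun t => by positivity

/-- `t ↦ d/(1+t²)` is integrable on `[a, b]`. -/
theorem integrableOn_atan_integrand (d a b : ℝ) :
    IntegrableOn (fun t : ℝ => d / (1 + t ^ 2)) (Icc a b) :=
  (continuous_atan_integrand d).continuousOn.integrableOn_compact isCompact_Icc

/-- The arctangent cell `A(d; a, b) = [[a, b], d/(1+x²)]`, `a, b, d` real algebraic. -/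
def atanSeg (d a b : ℝ) (hd : IsAlgebraic ℚ d) (ha : IsAlgebraic ℚ a) (hb : IsAlgebraic ℚ b) :
    IntegralRep 1 :=
  lineRep (Icc a b) (fun t => d / (1 + t ^ 2)) (isSemialgebraic_line_Icc ha hb)
    (isSemialgebraicFunOn_atan_integrand hd (isSemialgebraic_line_Icc ha hb))
    (integrableOn_atan_integrand d a b)

/-- `∫_a^b (1+x²)⁻¹ dx = arctan b − arctan a` (cast-free form). -/
theorem integral_inv_one_add_sq' (a b : ℝ) :
    ∫ x in a..b, (1 + x ^ 2)⁻¹ = Real.arctan b - Real.arctan a := by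
  simp

section atanSeg

variable {d a b : ℝ} {hd : IsAlgebraic ℚ d} {ha : IsAlgebraic ℚ a} {hb : IsAlgebraic ℚ b}

/-- The domain of `A(d; a, b)`. -/
@[simp] theorem atanSeg_domain : (atanSeg d a b hd ha hb).domain = line (Icc a b) := rfl

/-- The integrand of `A(d; a, b)`. -/
@[simp] theorem atanSeg_integrand :
    (atanSeg d a b hd ha hb).integrand = fun x => d / (1 + x 0 ^ 2) := rfl

/-- `value A(d; a, b) = d (arctan b − arctan a)` (`a ≤ b`). -/
theorem value_atanSeg (hab : a ≤ b) :
    (atanSeg d a b hd ha hb).value = d * (Real.arctan b - Real.arctan a) := by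
  rw [atanSeg, value_lineRep, integral_Icc_eq_integral_Ioc, ← intervalIntegral.integral_of_le hab]
  simp_rw [div_eq_mul_inv]
  rw [intervalIntegral.integral_const_mul, integral_inv_one_add_sq']

/-- A degenerate or empty arctangent cell is a relation. -/
theorem atanSeg_null (hba : b ≤ a) : of (atanSeg d a b hd ha hb) ∈ relations :=
  of_mem_relations_of_volume_eq_zero _ (by
    rw [atanSeg_domain, volume_line]
    exact measure_mono_null (fun x hx => le_antisymm (hx.2.trans hba) hx.1) Real.volume_singleton)

/-- `A(0; a, b) ≡ 0`. -/
theorem atanSeg_coeff_zero {h : IsAlgebraic ℚ (0:ℝ)} : of (atanSeg 0 a b h ha hb) ∈ relations :=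
  of_mem_relations_of_eqOn_zero _ fun x _ => by simp

/-- `A(d₁ + d₂; a, b) ≡ A(d₁; a, b) + A(d₂; a, b)`. -/
theorem atanSeg_coeff_add {d₁ d₂ : ℝ} {h₁ : IsAlgebraic ℚ d₁} {h₂ : IsAlgebraic ℚ d₂}
    {h₁₂ : IsAlgebraic ℚ (d₁ + d₂)} :
    of (atanSeg (d₁ + d₂) a b h₁₂ ha hb) - of (atanSeg d₁ a b h₁ ha hb) -
      of (atanSeg d₂ a b h₂ ha hb) ∈ relations :=
  of_sub_sub_mem_relations_of_add rfl rfl fun x _ => by simp [add_div]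

/-- `A(d; a, b) + A(−d; a, b) ≡ 0`. -/
theorem atanSeg_coeff_neg {hd' : IsAlgebraic ℚ (-d)} :
    of (atanSeg d a b hd ha hb) + of (atanSeg (-d) a b hd' ha hb) ∈ relations :=
  of_add_of_mem_relations_of_neg rfl fun x _ => by simp [neg_div]

/-- `A(k d; a, b) ≡ k • A(d; a, b)` for `k ∈ ℤ`. -/
theorem atanSeg_coeff_zsmul (k : ℤ) {hkd : IsAlgebraic ℚ (k * d)} :
    of (atanSeg (k * d) a b hkd ha hb) - k • of (atanSeg d a b hd ha hb) ∈ relations :=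
  of_sub_zsmul_mem_relations k rfl fun x _ => by simp [mul_div_assoc]

/-- Cells with equal parameters are equal representations. -/
theorem atanSeg_congr {d' a' b' : ℝ} (h₁ : d = d') (h₂ : a = a') (h₃ : b = b')
    {hd' : IsAlgebraic ℚ d'} {ha' : IsAlgebraic ℚ a'} {hb' : IsAlgebraic ℚ b'} :
    atanSeg d a b hd ha hb = atanSeg d' a' b' hd' ha' hb' := by
  subst h₁ h₂ h₃; rfl

/-- Splitting an arctangent cell: `A(d; a, b) ≡ A(d; a, l) + A(d; l, b)` for `a ≤ l ≤ b`. -/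
theorem atanSeg_split {l : ℝ} (hal : a ≤ l) (hlb : l ≤ b) {hl : IsAlgebraic ℚ l} :
    of (atanSeg d a b hd ha hb) - of (atanSeg d a l hd ha hl) - of (atanSeg d l b hd hl hb) ∈
      relations :=
  lineRep_split hal hlb _

/-- Reflecting an arctangent cell: `A(d; a, b) ≡ A(d; −b, −a)`. -/
theorem atanSeg_reflect {hA : IsAlgebraic ℚ (-b)} {hB : IsAlgebraic ℚ (-a)} :
    of (atanSeg d a b hd ha hb) - of (atanSeg d (-b) (-a) hd hA hB) ∈ relations := by
  refine lineRep_dilate (s := -1) (by simpa using isAlgebraic_one.neg (R := ℚ) (A := ℝ))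
    (by norm_num) ?_ ?_
  · ext y
    simp only [mem_Icc, mem_image]
    constructor
    · rintro ⟨h1, h2⟩
      exact ⟨-y, ⟨by linarith, by linarith⟩, by ring⟩
    · rintro ⟨t, ⟨h1, h2⟩, rfl⟩
      exact ⟨by linarith, by linarith⟩
  · intro t _
    simp

/-- **The Möbius move**: `A(d; 0, ρ') ≡ A(d; σ, ρ)` with `ρ' = (ρ − σ)/(1 + σρ)`, `0 ≤ σ ≤ ρ`:
the change of variables `v = (u + σ)/(1 − σu)` preserves `du/(1 + u²)`. -/
theorem atanSeg_moebius {σ ρ ρ' : ℝ} (hσ : 0 ≤ σ) (hσρ : σ ≤ ρ) (hρ' : ρ' = moebiusInv σ ρ)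
    {hσa : IsAlgebraic ℚ σ} {hρa : IsAlgebraic ℚ ρ} {h0 : IsAlgebraic ℚ (0:ℝ)}
    {hρ'a : IsAlgebraic ℚ ρ'} :
    of (atanSeg d 0 ρ' hd h0 hρ'a) - of (atanSeg d σ ρ hd hσa hρa) ∈ relations := by
  subst hρ'
  have hden : ∀ u ∈ Icc 0 (moebiusInv σ ρ), 0 < 1 - σ * u := fun u hu =>
    one_sub_mul_pos_of_le hσ hσρ hu.2
  have hS : IsSemialgebraic ℚ (line (Icc 0 (moebiusInv σ ρ))) := isSemialgebraic_line_Icc h0 hρ'a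
  refine lineRep_subst (moebius σ) (fun u => (1 + σ ^ 2) / (1 - σ * u) ^ 2) ?_ ?_ ?_ ?_ ?_
  · -- semialgebraicity of the Möbius map on the cell
    have h1 : IsSemialgebraicFunOn ℚ (line (Icc 0 (moebiusInv σ ρ)))
        ((fun x => x 0) + fun _ => σ) :=
      IsSemialgebraicFunOn.add_holds (isSemialgebraicFunOn_apply hS 0)
        (isSemialgebraicFunOn_const_of_isAlgebraic hS hσa)
    have h2 : IsSemialgebraicFunOn ℚ (line (Icc 0 (moebiusInv σ ρ)))
        ((fun _ => (1:ℝ)) - (fun _ => σ) * fun x => x 0) :=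
      IsSemialgebraicFunOn.sub_holds (isSemialgebraicFunOn_const_of_isAlgebraic hS isAlgebraic_one)
        (IsSemialgebraicFunOn.mul_holds (isSemialgebraicFunOn_const_of_isAlgebraic hS hσa)
          (isSemialgebraicFunOn_apply hS 0))
    exact (h1.div h2 fun x hx => (hden _ hx).ne').congr fun x _ => by simp [moebius]
  · intro u hu
    exact (hasDerivAt_moebius (hden u hu).ne').hasDerivWithinAt
  · exact moebius_injOn hden
  · ext v
    constructor
    · intro hv
      exact ⟨moebiusInv σ v, moebiusInv_mem_Icc hσ hv, moebius_moebiusInv hσ hv.1⟩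
    · rintro ⟨u, hu, rfl⟩
      exact moebius_mem_Icc hσ hσρ hu.1 hu.2
  · intro u hu
    have h1 := hden u hu
    have hne : (1 - σ * u) ≠ 0 := h1.ne'
    have h3 : (1 : ℝ) + u ^ 2 ≠ 0 := by positivity
    have h4 : (1 : ℝ) + σ ^ 2 ≠ 0 := by positivity
    have hpos2 : 0 < (1 + σ ^ 2) / (1 - σ * u) ^ 2 := by positivity
    have hne2 : (1 - σ * u) ^ 2 ≠ 0 := pow_ne_zero 2 hne
    have key : 1 + (moebius σ u) ^ 2 = (1 + σ ^ 2) * (1 + u ^ 2) / (1 - σ * u) ^ 2 := by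
      rw [moebius, div_pow, ← moebius_jacobian_identity, eq_div_iff hne2, add_mul, one_mul,
        div_mul_cancel₀ _ hne2]
    have hD : (1 + σ ^ 2) * (1 + u ^ 2) * (1 - σ * u) ^ 2 ≠ 0 := mul_ne_zero (mul_ne_zero h4 h3) hne2
    rw [abs_of_pos hpos2, key, div_div_eq_mul_div, div_mul_div_comm, div_eq_div_iff h3 hD]
    ring

end atanSeg

/-- The standard arctangent cell `A(d; τ) = [[0, τ], d/(1+x²)]`, value `d arctan τ`. -/
def atanCell (d τ : ℝ) (hd : IsAlgebraic ℚ d) (hτ : IsAlgebraic ℚ τ) : IntegralRep 1 :=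
  atanSeg d 0 τ hd isAlgebraic_zero hτ

section atanCell

variable {d τ : ℝ} {hd : IsAlgebraic ℚ d} {hτ : IsAlgebraic ℚ τ}

/-- Unfolding `A(d; τ) = A(d; 0, τ)`. -/
theorem atanCell_eq : atanCell d τ hd hτ = atanSeg d 0 τ hd isAlgebraic_zero hτ := rfl

/-- Standard arctangent cells with equal parameters are equal. -/
theorem atanCell_congr {d' τ' : ℝ} (h₁ : d = d') (h₂ : τ = τ') {hd' : IsAlgebraic ℚ d'}
    {hτ' : IsAlgebraic ℚ τ'} : atanCell d τ hd hτ = atanCell d' τ' hd' hτ' := by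
  subst h₁ h₂; rfl

/-- `value A(d; τ) = d arctan τ` (`0 ≤ τ`). -/
theorem value_atanCell (h0 : 0 ≤ τ) : (atanCell d τ hd hτ).value = d * Real.arctan τ := by
  rw [atanCell_eq, value_atanSeg h0, Real.arctan_zero, sub_zero]

/-- **Peeling move for angles**: `A(d; ρ) ≡ A(d; σ) + A(d; (ρ−σ)/(1+σρ))` for `0 ≤ σ ≤ ρ`
(split at `σ`, then the Möbius move on `[σ, ρ]`). -/
theorem atanCell_peel {ρ : ℝ} {hρ : IsAlgebraic ℚ ρ} (h0 : 0 ≤ τ) (hτρ : τ ≤ ρ) {ρ' : ℝ}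
    (hρ' : ρ' = (ρ - τ) / (1 + τ * ρ)) {hρ'a : IsAlgebraic ℚ ρ'} :
    of (atanCell d ρ hd hρ) - of (atanCell d τ hd hτ) - of (atanCell d ρ' hd hρ'a) ∈
      relations := by
  have hsplit := atanSeg_split (d := d) (a := 0) (b := ρ) (hd := hd) (ha := isAlgebraic_zero)
    (hb := hρ) h0 hτρ (hl := hτ)
  have hmob := atanSeg_moebius (d := d) (hd := hd) h0 hτρ (ρ' := ρ') (by rw [hρ', moebiusInv])
    (hσa := hτ) (hρa := hρ) (h0 := isAlgebraic_zero) (hρ'a := hρ'a)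
  have := relations.sub_mem hsplit hmob
  convert this using 1
  simp only [atanCell_eq]
  abel

end atanCell

end SoloBlind

end Summit.KontsevichZagierPeriods.KontsevichZagierPeriods.Theorems
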